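import Literature.MathematicalPhysics.KineticTheory.HardSphereEulerLLN
import Summits.AtomisticToContinuum.HydrodynamicLimit.Theorems.ImplosionDichotomyDenseExcursionTiedStaticsRatio
import Mathlib.Analysis.Calculus.InverseFunctionTheorem.Analytic
import Mathlib.Analysis.Analytic.OfScalars
import Mathlib.MeasureTheory.Measure.Lebesgue.VolumeOfBalls
import Mathlib.Analysis.Calculus.Deriv.MeanValue
import Mathlib.Analysis.Calculus.Deriv.Inv

/-!
# The analytic insertion factor of the low-density hard-sphere gas

Stub `stub_eosRatioAnalytic` (E1) of the line `log-lipschitz-budget` for the crux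
`ImplosionDichotomy.PolynomialCompression` (item stmt-AtomisticToContinuum-12587).

Write `Φ(u) := ∑_j b_j uʲ / j!` with `b_j = bE j` the cluster constants of
`HardSphereCanonicalTorus` (`|b_j| / j! ≤ e (e v₁)ʲ` by `abs_clusterCoeff_le`, so `Φ` is a real
power series of radius `≥ 1/(e v₁)`), `b₀ = 1`, `b₁ = -v₁ = -4π/3` (the landed
`TiedStaticsRatio.bE_one_eq`: the Ursell coefficient of two unit-diameter spheres is the Mayer
function `-𝟙[‖z‖ < 1]`). The limit insertion ratio `R(x)` at reduced density `x` solves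
`R · Φ(x R) = 1`; with `ψ(u) := u Φ(u)` (`ψ(0) = 0`, `ψ'(0) = 1`) it is `R = 1 / Φ(ψ⁻¹(x))`,
where `ψ⁻¹` is the analytic local inverse of `ψ` at `0` (Mathlib's analytic inverse function
theorem `AnalyticAt.analyticAt_localInverse`). We prove: `R` has a convergent power series at `0`,
`R(0) = 1`, `R'(0) = -b₁ = 4π/3`, `R > 0` solves the fixed-point equation on `(-r, r)`,
`1 ≤ R ≤ 2` and Lipschitz on `[0, r]`, and `R(x)` is the only root of `ρ ↦ ρ Φ(xρ) = 1` in
`[1/2, 2]` (injectivity of `ψ` near `0`), for some `r > 0`.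

The analysis is done for an abstract `Φ` analytic at `0` with `Φ 0 = 1`, `Φ' (0) < 0`
(`exists_ratio_of_analytic`), and then specialised to the cluster series (`eosPhi_spec`).
-/

namespace Summit.AtomisticToContinuum.HydrodynamicLimit.Theorems

open Set MeasureTheory Filter Topology
open Literature.MathematicalPhysics.KineticTheory
open Literature.Analysis.FunctionSpaces

namespace EosRatioAnalytic

/-! ### The cluster constants: `b₀ = 1` and the bound `|b_j| / j! ≤ e (e v₁)ʲ`

(`b₁ = -4π/3` is `TiedStaticsRatio.bE_one_eq` of the landed
`Theorems/ImplosionDichotomyDenseExcursionTiedStaticsRatio.lean`.) -/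

/-- The zeroth cluster constant is `b₀ = 1` (the Ursell coefficient of a single sphere). -/
theorem bE_zero : bE 0 = 1 := by
  have h := coefLim_one_zero (P := uniformProfile) (σ := 1 / 4) (by norm_num)
  have hc : coefLim uniformProfile (1 / 4) (fun _ => 1) 0 = clusterCoeff (1 / 4) 0 := by
    rw [coefLim]
    simp [uniformProfile]
  rw [hc, clusterCoeff] at h
  simpa using h

/-- **Exponential bound on the cluster constants**: `|b_j| / j! ≤ e (e v₁)ʲ` (from
`abs_clusterCoeff_le` at `σ = 1/4`, dividing out `σ^{3j}`). -/
theorem abs_bE_div_factorial_le (j : ℕ) :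
    |bE j / (j.factorial : ℝ)| ≤ Real.exp 1 * (Real.exp 1 * v₁) ^ j := by
  have h := abs_clusterCoeff_le (σ := 1 / 4) (by norm_num) (by norm_num) j
  rw [clusterCoeff] at h
  have hσ : (0 : ℝ) < ((1 / 4 : ℝ) ^ 3) ^ j := by positivity
  rw [show ((1 / 4 : ℝ) ^ 3) ^ j / (j.factorial : ℝ) * bE j =
      ((1 / 4 : ℝ) ^ 3) ^ j * (bE j / j.factorial) by ring, abs_mul, abs_of_pos hσ,
    show Real.exp 1 * (Real.exp 1 * (v₁ * (1 / 4 : ℝ) ^ 3)) ^ j =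
      ((1 / 4 : ℝ) ^ 3) ^ j * (Real.exp 1 * (Real.exp 1 * v₁) ^ j) by ring] at h
  exact le_of_mul_le_mul_left h hσ

/-! ### The insertion series `Φ(u) = ∑_j b_j uʲ / j!` -/

/-- **The insertion series.** There is a function `Φ` with `Φ u = ∑_j b_j uʲ / j!` for all `u`,
analytic at `0`, with `Φ 0 = 1` and `Φ' (0) = b₁ = -4π/3` (`TiedStaticsRatio.bE_one_eq`). -/
theorem eosPhi_spec :
    ∃ Φ : ℝ → ℝ, (∀ u, Φ u = ∑' j : ℕ, bE j / (j.factorial : ℝ) * u ^ j) ∧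
      AnalyticAt ℝ Φ 0 ∧ Φ 0 = 1 ∧ deriv Φ 0 = -(4 * Real.pi / 3) := by
  set a : ℕ → ℝ := fun j => bE j / (j.factorial : ℝ) with ha
  have hrad : 0 < (FormalMultilinearSeries.ofScalars ℝ a).radius := by
    have hv := v₁_pos
    have hq : (0 : ℝ) < (2 * (Real.exp 1 * v₁))⁻¹ := by positivity
    set r₀ : NNReal := ⟨(2 * (Real.exp 1 * v₁))⁻¹, hq.le⟩ with hr₀
    have hr₀pos : (0 : ENNReal) < r₀ := by
      rw [ENNReal.coe_pos, ← NNReal.coe_pos]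
      exact hq
    refine lt_of_lt_of_le hr₀pos
      ((FormalMultilinearSeries.ofScalars ℝ a).le_radius_of_bound (Real.exp 1) fun n => ?_)
    rw [FormalMultilinearSeries.ofScalars_norm, Real.norm_eq_abs]
    have hr₀' : (r₀ : ℝ) = (2 * (Real.exp 1 * v₁))⁻¹ := rfl
    calc |a n| * (r₀ : ℝ) ^ n ≤ Real.exp 1 * (Real.exp 1 * v₁) ^ n * (r₀ : ℝ) ^ n := by
          gcongr
          exact abs_bE_div_factorial_le n
      _ = Real.exp 1 * ((Real.exp 1 * v₁) * r₀) ^ n := by rw [mul_pow]; ring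
      _ = Real.exp 1 * (1 / 2) ^ n := by
          rw [hr₀']
          congr 2
          field_simp
      _ ≤ Real.exp 1 := mul_le_of_le_one_right (Real.exp_pos 1).le
          (pow_le_one₀ (by norm_num) (by norm_num))
  have hball := (FormalMultilinearSeries.ofScalars ℝ a).hasFPowerSeriesOnBall hrad
  refine ⟨(FormalMultilinearSeries.ofScalars ℝ a).sum, fun u => ?_, hball.analyticAt, ?_, ?_⟩
  · change FormalMultilinearSeries.ofScalarsSum a u = _
    rw [FormalMultilinearSeries.ofScalars_sum_eq]
    simp only [smul_eq_mul, ha]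
  · change FormalMultilinearSeries.ofScalarsSum a 0 = 1
    rw [FormalMultilinearSeries.ofScalarsSum_zero]
    simp [ha, bE_zero]
  · rw [hball.hasFPowerSeriesAt.deriv, FormalMultilinearSeries.ofScalars_apply_eq]
    simp [ha, TiedStaticsRatio.bE_one_eq]

/-! ### Local analytic inversion of `ψ(u) = u Φ(u)` -/

/-- **The analytic local inverse of `u ↦ u Φ(u)`.** For `Φ` analytic at `0` with `Φ 0 = 1` there
is `g` analytic at `0` with `g 0 = 0`, `g' (0) = 1`, `g x · Φ (g x) = x` near `0`, and
neighbourhoods `s, t` of `0` such that `u ↦ u Φ(u)` is injective on `s` and `g` maps `t` into `s`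
(Mathlib's inverse function theorem, `HasStrictFDerivAt.toOpenPartialHomeomorph`, and its analytic
upgrade `AnalyticAt.analyticAt_localInverse`). -/
theorem exists_localInverse_of_analytic {Φ : ℝ → ℝ} (hΦa : AnalyticAt ℝ Φ 0)
    (hΦ0 : Φ 0 = 1) :
    ∃ g : ℝ → ℝ, AnalyticAt ℝ g 0 ∧ g 0 = 0 ∧ HasStrictDerivAt g 1 0 ∧
      (∀ᶠ x in 𝓝 0, g x * Φ (g x) = x) ∧
      ∃ s t : Set ℝ, s ∈ 𝓝 (0 : ℝ) ∧ t ∈ 𝓝 (0 : ℝ) ∧ InjOn (fun u => u * Φ u) s ∧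
        MapsTo g t s := by
  obtain ⟨ψ, hψ⟩ : ∃ ψ : ℝ → ℝ, ψ = fun u => u * Φ u := ⟨_, rfl⟩
  have hψa : AnalyticAt ℝ ψ 0 := by
    rw [hψ]
    exact analyticAt_id.mul hΦa
  have hψ0 : ψ 0 = 0 := by simp [hψ]
  have hψd : deriv ψ 0 = 1 := by
    have h := (hasDerivAt_id (0 : ℝ)).mul hΦa.differentiableAt.hasDerivAt
    have h' : HasDerivAt ψ 1 0 := by
      rw [hψ]
      exact h.congr_deriv (by simp [hΦ0])
    exact h'.deriv
  have hne : deriv ψ 0 ≠ 0 := by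
    rw [hψd]
    exact one_ne_zero
  have hsd : HasStrictDerivAt ψ (deriv ψ 0) 0 := hψa.hasStrictDerivAt
  have key : ∀ u, ψ u = u * Φ u := fun u => by rw [hψ]
  set Ψ := (hsd.hasStrictFDerivAt_equiv hne).toOpenPartialHomeomorph ψ with hΨ
  refine ⟨hsd.localInverse ψ (deriv ψ 0) 0 hne, ?_, ?_, ?_, ?_, Ψ.source, Ψ.target,
    ?_, ?_, ?_, ?_⟩
  · have h := hψa.analyticAt_localInverse hne
    rwa [hψ0] at h
  · have h := (hsd.eventually_left_inverse hne).self_of_nhds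
    rwa [hψ0] at h
  · have h := hsd.to_localInverse hne
    rw [hψ0] at h
    exact h.congr_deriv (by rw [hψd, inv_one])
  · have h := hsd.eventually_right_inverse hne
    rw [hψ0] at h
    filter_upwards [h] with x hx
    rwa [key] at hx
  · exact Ψ.open_source.mem_nhds
      (hsd.hasStrictFDerivAt_equiv hne).mem_toOpenPartialHomeomorph_source
  · have h := (hsd.hasStrictFDerivAt_equiv hne).image_mem_toOpenPartialHomeomorph_target
    rw [hψ0] at h
    exact Ψ.open_target.mem_nhds h
  · intro u hu v hv huv
    refine Ψ.injOn hu hv ?_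
    change ψ u = ψ v
    rw [key, key]
    exact huv
  · intro y hy
    exact Ψ.map_target hy

/-- **The insertion factor of an abstract insertion series.** For `Φ` analytic at `0` with
`Φ 0 = 1` and `Φ' (0) < 0` there are `r > 0` and `Rf` with a power series converging on the ball
of radius `r`, `Rf 0 = 1`, `Rf' (0) = -Φ' (0)`, `0 < Rf` solving `Rf x · Φ(x Rf x) = 1` on
`(-r, r)`, `1 ≤ Rf ≤ 2` and Lipschitz on `[0, r]`, and `Rf x` the only root of `R Φ(x R) = 1` in
`[1/2, 2]` for `|x| < r`. Construction: `Rf = 1 / (Φ ∘ g)` with `g` the local inverse of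
`u ↦ u Φ(u)`; everything else is continuity at `0` and a choice of `r` small. -/
theorem exists_ratio_of_analytic {Φ : ℝ → ℝ} (hΦa : AnalyticAt ℝ Φ 0) (hΦ0 : Φ 0 = 1)
    (hΦneg : deriv Φ 0 < 0) :
    ∃ r : ℝ, 0 < r ∧ ∃ Rf : ℝ → ℝ,
      (∃ p : FormalMultilinearSeries ℝ ℝ ℝ,
        HasFPowerSeriesOnBall Rf p 0 (ENNReal.ofReal r)) ∧
      Rf 0 = 1 ∧ deriv Rf 0 = -deriv Φ 0 ∧
      (∀ x ∈ Ioo (-r) r, 0 < Rf x ∧ Rf x * Φ (x * Rf x) = 1) ∧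
      (∀ x ∈ Icc 0 r, 1 ≤ Rf x ∧ Rf x ≤ 2) ∧
      (∃ L : NNReal, LipschitzOnWith L Rf (Icc 0 r)) ∧
      (∀ x ∈ Ioo (-r) r, ∀ R ∈ Icc (1 / 2 : ℝ) 2, R * Φ (x * R) = 1 → R = Rf x) := by
  obtain ⟨g, hga, hg0, hgd, hright, s, t, hs, ht, hinj, hmaps⟩ :=
    exists_localInverse_of_analytic hΦa hΦ0
  obtain ⟨Rf, hRf⟩ : ∃ Rf : ℝ → ℝ, Rf = fun x => (Φ (g x))⁻¹ := ⟨_, rfl⟩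
  have hΦga : AnalyticAt ℝ (fun x => Φ (g x)) 0 := hΦa.fun_comp_of_eq hga hg0
  have hΦg0 : Φ (g 0) = 1 := by rw [hg0, hΦ0]
  have hΦgne : Φ (g 0) ≠ 0 := by
    rw [hΦg0]
    exact one_ne_zero
  have hRfa : AnalyticAt ℝ Rf 0 := by
    rw [hRf]
    exact hΦga.fun_inv hΦgne
  have hRf0 : Rf 0 = 1 := by simp [hRf, hΦg0]
  -- the derivative at `0`
  have hΦgd : HasDerivAt (fun x => Φ (g x)) (deriv Φ 0 * 1) 0 := by
    have h1 : HasDerivAt Φ (deriv Φ 0) (g 0) := by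
      rw [hg0]
      exact hΦa.differentiableAt.hasDerivAt
    exact h1.comp 0 hgd.hasDerivAt
  have hRfd' : HasDerivAt Rf (-deriv Φ 0) 0 := by
    rw [hRf]
    refine (hΦgd.fun_inv hΦgne).congr_deriv ?_
    rw [hΦg0]
    ring
  have hRfd : deriv Rf 0 = -deriv Φ 0 := hRfd'.deriv
  -- what holds near `0`
  have hev_pos : ∀ᶠ x in 𝓝 0, 1 / 2 < Φ (g x) :=
    hΦga.continuousAt.eventually
      (lt_mem_nhds (show (1 / 2 : ℝ) < Φ (g 0) by rw [hΦg0]; norm_num))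
  have hev_an : ∀ᶠ x in 𝓝 0, AnalyticAt ℝ Rf x := hRfa.eventually_analyticAt
  have hev_der : ∀ᶠ x in 𝓝 0, 0 < deriv Rf x :=
    hRfa.deriv.continuousAt.eventually (lt_mem_nhds (by rw [hRfd]; linarith))
  obtain ⟨K, sL, hsL, hLipK⟩ := hRfa.hasStrictFDerivAt.exists_lipschitzOnWith
  obtain ⟨p, ρ, hp⟩ := hRfa
  obtain ⟨ρ', -, hρ'pos, hρ'lt⟩ := ENNReal.lt_iff_exists_real_btwn.1 hp.r_pos
  have hρ' : 0 < ρ' := ENNReal.ofReal_pos.1 hρ'pos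
  have hev : ∀ᶠ x in 𝓝 (0 : ℝ), g x * Φ (g x) = x ∧ 1 / 2 < Φ (g x) ∧
      AnalyticAt ℝ Rf x ∧ 0 < deriv Rf x ∧ x ∈ s ∧ x ∈ t ∧ x ∈ sL :=
    hright.and (hev_pos.and (hev_an.and (hev_der.and ((Filter.eventually_mem_set.2 hs).and
      ((Filter.eventually_mem_set.2 ht).and (Filter.eventually_mem_set.2 hsL))))))
  obtain ⟨δ, hδ, hδP⟩ := Metric.eventually_nhds_iff.1 hev
  have hball : ∀ y : ℝ, |y| < δ → g y * Φ (g y) = y ∧ 1 / 2 < Φ (g y) ∧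
      AnalyticAt ℝ Rf y ∧ 0 < deriv Rf y ∧ y ∈ s ∧ y ∈ t ∧ y ∈ sL :=
    fun y hy => hδP (by rwa [Real.dist_eq, sub_zero])
  -- pointwise consequences on the ball of radius `δ`
  have hfix : ∀ y : ℝ, |y| < δ →
      g y = y * Rf y ∧ 0 < Rf y ∧ Rf y * Φ (y * Rf y) = 1 ∧ Rf y ≤ 2 := by
    intro y hy
    obtain ⟨hy1, hy2, -⟩ := hball y hy
    have hne : Φ (g y) ≠ 0 := by linarith
    have hgy : g y = y * Rf y := by
      rw [hRf]
      exact (eq_mul_inv_iff_mul_eq₀ hne).2 hy1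
    refine ⟨hgy, ?_, ?_, ?_⟩
    · rw [hRf]
      exact inv_pos.2 (by linarith)
    · rw [← hgy, hRf]
      exact inv_mul_cancel₀ hne
    · rw [hRf]
      exact inv_le_of_inv_le₀ (by norm_num) (by linarith)
  have hmono : StrictMonoOn Rf (Ioo (-δ) δ) := by
    refine strictMonoOn_of_deriv_pos (convex_Ioo _ _) (fun y hy => ?_) (fun y hy => ?_)
    · exact (hball y (abs_lt.2 hy)).2.2.1.differentiableAt.continuousAt.continuousWithinAt
    · rw [interior_Ioo] at hy
      exact (hball y (abs_lt.2 hy)).2.2.2.1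
  -- the radius
  set r : ℝ := min δ ρ' / 4 with hr
  have hr0 : 0 < r := by
    rw [hr]
    positivity
  have hrδ : 2 * r < δ := by
    have : min δ ρ' ≤ δ := min_le_left _ _
    rw [hr]
    linarith
  have hrρ : r ≤ ρ' := by
    have : min δ ρ' ≤ ρ' := min_le_right _ _
    rw [hr]
    linarith [hρ']
  have hIoo : ∀ x ∈ Ioo (-r) r, |x| < δ := fun x hx => by
    rw [abs_lt]
    constructor <;> linarith [hx.1, hx.2]
  have hIcc : ∀ x ∈ Icc 0 r, |x| < δ := fun x hx => by
    rw [abs_lt]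
    constructor <;> linarith [hx.1, hx.2]
  refine ⟨r, hr0, Rf, ⟨p, hp.mono (ENNReal.ofReal_pos.2 hr0)
    ((ENNReal.ofReal_le_ofReal hrρ).trans hρ'lt.le)⟩, hRf0, hRfd, fun x hx => ?_,
    fun x hx => ?_, ⟨K, hLipK.mono fun y hy => (hball y (hIcc y hy)).2.2.2.2.2.2⟩,
    fun x hx R hR hR1 => ?_⟩
  · exact ⟨(hfix x (hIoo x hx)).2.1, (hfix x (hIoo x hx)).2.2.1⟩
  · refine ⟨?_, (hfix x (hIcc x hx)).2.2.2⟩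
    rw [← hRf0]
    exact hmono.monotoneOn (by constructor <;> linarith) (abs_lt.1 (hIcc x hx)) hx.1
  · -- uniqueness of the root in `[1/2, 2]`: injectivity of `u ↦ u Φ(u)` near `0`
    have hxδ : |x| < δ := hIoo x hx
    obtain ⟨hx1, -, -, -, -, hxt, -⟩ := hball x hxδ
    have hxR : |x * R| < δ := by
      rw [abs_mul, abs_of_pos (by linarith [hR.1] : (0 : ℝ) < R)]
      calc |x| * R ≤ |x| * 2 := by gcongr; exact hR.2
        _ < δ := by linarith [(abs_lt.2 ⟨by linarith [hx.1], hx.2⟩ : |x| < r)]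
    have hxRs : x * R ∈ s := (hball (x * R) hxR).2.2.2.2.1
    have hgxs : g x ∈ s := hmaps hxt
    have heq : x * R * Φ (x * R) = g x * Φ (g x) := by rw [hx1, mul_assoc, hR1, mul_one]
    have hinj' : x * R = g x := hinj hxRs hgxs heq
    rw [(hfix x hxδ).1] at hinj'
    by_cases hx0 : x = 0
    · subst hx0
      rw [zero_mul, hΦ0, mul_one] at hR1
      rw [hR1, hRf0]
    · exact mul_left_cancel₀ hx0 hinj'

end EosRatioAnalytic

/-! ### The stub -/

open EosRatioAnalytic in
/-- **The analytic insertion factor** (stub `stub_eosRatioAnalytic`, E1, of the line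
`log-lipschitz-budget`). There are `r > 0` and `Rf : ℝ → ℝ` with a power series at `0`
converging on the ball of radius `r`, `Rf 0 = 1`, `Rf′(0) = 4π/3`, solving
`Rf x · Φ(x · Rf x) = 1` with `0 < Rf x` on `(−r, r)` (`Φ(u) = ∑_j bE j · uʲ / j!` the insertion
series of the cluster constants), `1 ≤ Rf x ≤ 2` and Lipschitz on `[0, r]`, and `Rf x` is the
ONLY root of `R · Φ(xR) = 1` in `[1/2, 2]` for `|x| < r`. -/
theorem stub_eosRatioAnalytic :
    ∃ r : ℝ, 0 < r ∧ ∃ Rf : ℝ → ℝ,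
      (∃ p : FormalMultilinearSeries ℝ ℝ ℝ, HasFPowerSeriesOnBall Rf p 0 (ENNReal.ofReal r)) ∧
      Rf 0 = 1 ∧ deriv Rf 0 = 4 * Real.pi / 3 ∧
      (∀ x ∈ Ioo (-r) r, 0 < Rf x ∧
        Rf x * (∑' j : ℕ, bE j / (j.factorial : ℝ) * (x * Rf x) ^ j) = 1) ∧
      (∀ x ∈ Icc 0 r, 1 ≤ Rf x ∧ Rf x ≤ 2) ∧
      (∃ L : NNReal, LipschitzOnWith L Rf (Icc 0 r)) ∧
      (∀ x ∈ Ioo (-r) r, ∀ R ∈ Icc (1 / 2 : ℝ) 2,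
        R * (∑' j : ℕ, bE j / (j.factorial : ℝ) * (x * R) ^ j) = 1 → R = Rf x) := by
  obtain ⟨Φ, hΦeq, hΦa, hΦ0, hΦd⟩ := eosPhi_spec
  have hneg : deriv Φ 0 < 0 := by
    rw [hΦd]
    have := Real.pi_pos
    linarith
  obtain ⟨r, hr, Rf, hps, h0, hd, hsol, hbd, hLip, huniq⟩ :=
    exists_ratio_of_analytic hΦa hΦ0 hneg
  refine ⟨r, hr, Rf, hps, h0, ?_, fun x hx => ?_, hbd, hLip, fun x hx R hR h => ?_⟩
  · rw [hd, hΦd, neg_neg]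
  · rw [← hΦeq]
    exact hsol x hx
  · rw [← hΦeq] at h
    exact huniq x hx R hR h

end Summit.AtomisticToContinuum.HydrodynamicLimit.Theorems
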